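import Literature.NumberTheory.Sieve.FGKMT2018MainTermRegroup
import Literature.NumberTheory.Sieve.FGKMT2018YSquareSumBridge
import HarnessLib

/-!
# FGKMT 2018 Theorem 6 (i) / Maynard 2016 Prop. 9.1 (`𝒜 = ℤ`): reduction to Lemma 8.4's `r`-fold sum

Sources: J. Maynard, *Dense clusters of primes in subsets*, Compositio Math. 152 (2016) =
arXiv:1405.2593 [Maynard2016DenseClusters], proof of Proposition 9.1 pp. 19–20 ((9.1)–(9.5), the
`y`-difference step via Lemma 8.3, and (9.4) «by applying Lemma 8.4»); K. Ford, B. Green,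
S. Konyagin, J. Maynard, T. Tao, *Long gaps between primes*, JAMS 31 (2018) = arXiv:1412.5029v4
[FordGreenKonyaginMaynardTao2018], Theorem 6 (i) (7.12) p. 21.

PROVED here (no named facts) — the one-line assembly of `FGKMT2018MainTermRegroup` and
`FGKMT2018YSquareSumBridge`:

* **`abs_sum_sieveWt_sub_rFoldSum_le`** (`k ≥ 2`, `R > 1`, `F = F_k`):
  `|∑_{n ∈ 𝒜(X)} w_n − #𝒜(X)·(φ_ω(W)/W)·P²·rFoldSum k W⃗ (p ↦ p − ω(p)) (ψ²) (g_k²) R 0|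
     ≤ |#𝒜(X)·(φ_ω(W)/W)·E_diff| + φ_ω(W)·(∑_d |λ_d|)²`,
  `P = (WB)^k/φ(WB)^k 𝔖_{WB}(𝓛)`, `E_diff = ∑_{r,s} y_r (y_s − y_r) T(r,s)/φ_ω(r)²`.
  So Proposition 9.1 for `𝒜 = ℤ` (`Maynard2016DenseClusters_prop91Z`) is reduced to three analytic
  inputs: Lemma 8.4 for the `r`-fold sum (tree: `MaynardDense.lemma84_all`, `orthInt_profExt_sq_psi_sq`;
  mind the `K`-threshold caveat recorded in `FGKMT2018YSquareSumBridge`), Lemma 8.3-type control of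
  `y_s − y_r` for `E_diff`, and Lemma 8.5 (i) (`λ_max`) with `card_dkBox_filter_prod_lt_le` for the
  last term; the prefactor algebra is `FGKMT2018MainTermPrefactor.mainTerm_prefactor_eq`.

## References
* J. Maynard, *Dense clusters of primes in subsets*, Compositio Math. 152 (2016), Prop. 9.1
  [Maynard2016DenseClusters].
* K. Ford, B. Green, S. Konyagin, J. Maynard, T. Tao, *Long gaps between primes*, JAMS 31 (2018),
  Theorem 6 (i) [FordGreenKonyaginMaynardTao2018].
-/

noncomputable section

open Finset
open scoped ArithmeticFunction.Moebius

namespace Literature.NumberTheory.Sieve.FGKMT2018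

variable {k : ℕ}

/-- **Prop. 9.1 (`𝒜 = ℤ`) reduced to the `r`-fold sum of Lemma 8.4**:
`|∑_{n ∈ 𝒜(X)} w_n − #𝒜(X)(φ_ω(W)/W) P² rFoldSum(…)| ≤ |#𝒜(X)(φ_ω(W)/W) E_diff| + φ_ω(W)(∑_d|λ_d|)²`.
[cite: Maynard2016DenseClusters, proof of Prop. 9.1 pp. 19–20 ((9.1)–(9.5), (9.4)); FordGreenKonyaginMaynardTao2018, Theorem 6 (i) p. 21] -/
theorem abs_sum_sieveWt_sub_rFoldSum_le {k : ℕ} (hk : 2 ≤ k) (X : ℝ) {L : Fin k → ℤ × ℤ}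
    (hadm : FormsAdmissible L) (B : ℕ) {R : ℝ} (hR : 1 < R) :
    |∑ n ∈ dyadZ X, sieveWt L B R (MaynardDense.F k) n -
        (#(dyadZ X) : ℝ) * phiOmega L (wCut k B) / (wCut k B : ℝ) *
          ((((wCut k B * B : ℕ) : ℝ) ^ k / (Nat.totient (wCut k B * B) : ℝ) ^ k *
              singSeriesExcl L (wCut k B * B)) ^ 2 *
            MaynardDense.rFoldSum k (idxMod L B R) (fun p => (p : ℝ) - omegaL L p)
              (fun x => MaynardDense.psi x ^ 2) (fun t => MaynardDense.profExt k t ^ 2) R 0)|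
      ≤ |(#(dyadZ X) : ℝ) * phiOmega L (wCut k B) / (wCut k B : ℝ) *
            ∑ r ∈ dkBox L B R, ∑ s ∈ dkBox L B R,
              yVar L B R (MaynardDense.F k) r *
                  (yVar L B R (MaynardDense.F k) s - yVar L B R (MaynardDense.F k) r) /
                phiOmega L (∏ i, r i) ^ 2 * localPairSum L B R r s| +
        phiOmega L (wCut k B) * (∑ d ∈ dkBox L B R, |lamVar L B R (MaynardDense.F k) d|) ^ 2 := by
  have h := abs_sum_sieveWt_sub_mainSum_le X hadm B hR (MaynardDense.F k)
  rw [sum_yVar_sq_div_phiOmega_eq_rFoldSum hk L B hR] at h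
  -- `|S − cM| ≤ |S − c(M + E)| + |cE|`
  set S := ∑ n ∈ dyadZ X, sieveWt L B R (MaynardDense.F k) n with hS
  set c := (#(dyadZ X) : ℝ) * phiOmega L (wCut k B) / (wCut k B : ℝ) with hc
  set M := (((wCut k B * B : ℕ) : ℝ) ^ k / (Nat.totient (wCut k B * B) : ℝ) ^ k *
      singSeriesExcl L (wCut k B * B)) ^ 2 *
    MaynardDense.rFoldSum k (idxMod L B R) (fun p => (p : ℝ) - omegaL L p)
      (fun x => MaynardDense.psi x ^ 2) (fun t => MaynardDense.profExt k t ^ 2) R 0 with hM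
  set E := ∑ r ∈ dkBox L B R, ∑ s ∈ dkBox L B R,
      yVar L B R (MaynardDense.F k) r *
          (yVar L B R (MaynardDense.F k) s - yVar L B R (MaynardDense.F k) r) /
        phiOmega L (∏ i, r i) ^ 2 * localPairSum L B R r s with hE
  set Q := phiOmega L (wCut k B) * (∑ d ∈ dkBox L B R, |lamVar L B R (MaynardDense.F k) d|) ^ 2
    with hQ
  have hsplit : S - c * M = (S - c * (M + E)) + c * E := by ring
  calc |S - c * M| = |(S - c * (M + E)) + c * E| := by rw [hsplit]
    _ ≤ |S - c * (M + E)| + |c * E| := abs_add_le _ _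
    _ ≤ Q + |c * E| := by linarith [h]
    _ = |c * E| + Q := add_comm _ _

end Literature.NumberTheory.Sieve.FGKMT2018
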